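import Literature.AlgebraicGeometry.Resolution.AffineBlowup
import Literature.RingTheory.TightClosure.RegularTightlyClosed
import Mathlib.Algebra.CharP.Algebra
import Mathlib.RingTheory.Regular.RegularSequence
import HarnessLib

/-!
# `FRationalModification`: the stub `stub_isolatedSingularityBlowupCertificate` follows from ONE regular `𝔪`-primary blow-up

Support lemma for crux stmt-ResolutionOfSingularities-15316
(`Summit.ResolutionOfSingularities.ResolutionOfSingularities.Theses.FrobeniusLadder.FRationalModification`, route FrobeniusLadder),
line `socle-discrepancy-certificate`, skeleton a75e9df03fa5200e. KILL-CRITERION bookkeeping for the registered local stub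
`stub_isolatedSingularityBlowupCertificate` (an isolated Cohen–Macaulay F-injective non-F-rational germ `R`, not a «door»
hypersurface, admits an `𝔪`-primary ideal `I` whose blowing up has, at every point, an F-rational stalk or a regular
hypersurface section with CM F-injective quotient): the conclusion holds — through its FIRST disjunct at every point — as soon
as some `𝔪`-primary `I` has a REGULAR blowing up `Bl_I Spec R`, with no use of the stub's hypotheses on `R`. Indeed a regular
local ring of characteristic `p` (through `R → Γ(Spec R) → Γ(Bl_I) → 𝒪_{Bl_I,w}`, `CharP.of_ringHom_of_ne_zero`) is a domain in
which every ideal is tightly closed (`isTightlyClosed_of_isRegularLocalRing`, Hochster–Huneke via Kunz, unfolded to the inline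
clause by `isTightlyClosed_iff_of_isDomain`), in particular every parameter ideal. So the stub sits below «the isolated
singularity `Spec R` is resolved by a single `𝔪`-primary blow-up» — consistent, and open exactly where that is.

* `isolatedSingularityBlowupCertificate_of_isRegular_affineBlowup` — the implication, conclusion verbatim from the registered stub.
[folklore; HochsterHuneke1990 Thm. 4.4; StacksProject Tag 02IS]
-/

-- single-problem summit: the doubled namespace component is forced
set_option linter.dupNamespace false

noncomputable section

open CategoryTheory AlgebraicGeometry TopologicalSpace IsLocalRing
open Literature.AlgebraicGeometry.Resolution Literature.RingTheory.TightClosure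

namespace Summit.ResolutionOfSingularities.ResolutionOfSingularities.Theorems.FRationalModification.BlowupCertificateOfRegularBlowup

/-- **One regular `𝔪`-primary blow-up certifies `stub_isolatedSingularityBlowupCertificate`.** Let `R` be a local domain of prime
characteristic `p` and `I` an ideal with `I ≤ 𝔪 ≤ √I` whose blowing up `Bl_I Spec R` (`affineBlowup I`) is a REGULAR scheme. Then
the conclusion of the registered stub holds with this `I`: at every point `w` the stalk is a domain all of whose parameter ideals
(indeed all ideals) are tightly closed — regular local rings of characteristic `p` are weakly F-regular
(`isTightlyClosed_of_isRegularLocalRing`, `isTightlyClosed_iff_of_isDomain`; the characteristic reaches the stalk along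
`R → Γ(Spec R, ⊤) → Γ(Bl_I, ⊤) → 𝒪_w`). [folklore; HochsterHuneke1990 Thm. 4.4] -/
theorem isolatedSingularityBlowupCertificate_of_isRegular_affineBlowup (p : ℕ) [Fact p.Prime] (R : Type) [CommRing R]
    [IsLocalRing R] [IsDomain R] [CharP R p] (I : Ideal R) (hI : I ≤ IsLocalRing.maximalIdeal R)
    (hrad : IsLocalRing.maximalIdeal R ≤ I.radical) (hreg : Scheme.IsRegular (affineBlowup I)) :
    ∃ I : Ideal R, I ≤ IsLocalRing.maximalIdeal R ∧ IsLocalRing.maximalIdeal R ≤ I.radical ∧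
      ∀ w : affineBlowup I, (IsDomain ((affineBlowup I).presheaf.stalk w) ∧
        ∀ d : ℕ, ringKrullDim ((affineBlowup I).presheaf.stalk w) = d →
        ∀ s : Fin d → ((affineBlowup I).presheaf.stalk w), (Ideal.span (Set.range s)).radical.IsMaximal →
        ∀ u c : ((affineBlowup I).presheaf.stalk w), c ≠ 0 →
        (∀ e : ℕ, c * u ^ p ^ e ∈ Ideal.span ((fun z : ((affineBlowup I).presheaf.stalk w) => z ^ p ^ e) ''
          (Ideal.span (Set.range s) : Set ((affineBlowup I).presheaf.stalk w)))) → u ∈ Ideal.span (Set.range s)) ∨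
      (IsDomain (((affineBlowup I).presheaf.stalk w)) ∧ ∃ t : ((affineBlowup I).presheaf.stalk w),
        t ∈ IsLocalRing.maximalIdeal (((affineBlowup I).presheaf.stalk w)) ∧ t ≠ 0 ∧ IsRegularRing (Localization.Away t) ∧
        (∀ d : ℕ, ringKrullDim (((affineBlowup I).presheaf.stalk w) ⧸ Ideal.span {t}) = d →
          ∀ s : Fin d → ((affineBlowup I).presheaf.stalk w) ⧸ Ideal.span {t}, (Ideal.span (Set.range s)).radical.IsMaximal →
          RingTheory.Sequence.IsWeaklyRegular (((affineBlowup I).presheaf.stalk w) ⧸ Ideal.span {t}) (List.ofFn s) ∧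
          ∀ u : ((affineBlowup I).presheaf.stalk w) ⧸ Ideal.span {t},
          (∃ e : ℕ, u ^ p ^ e ∈ Ideal.span ((fun z : ((affineBlowup I).presheaf.stalk w) ⧸ Ideal.span {t} => z ^ p ^ e) ''
            (Ideal.span (Set.range s) : Set (((affineBlowup I).presheaf.stalk w) ⧸ Ideal.span {t})))) →
            u ∈ Ideal.span (Set.range s))) := by
  have hp : p.Prime := Fact.out
  refine ⟨I, hI, hrad, fun w => Or.inl ?_⟩
  haveI : IsRegularLocalRing ((affineBlowup I).presheaf.stalk w) := hreg w
  haveI : IsDomain ((affineBlowup I).presheaf.stalk w) := isDomain_of_isRegularLocalRing _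
  haveI : CharP ((affineBlowup I).presheaf.stalk w) p :=
    CharP.of_ringHom_of_ne_zero
      (((affineBlowup I).presheaf.germ ⊤ w trivial).hom.comp
        ((affineBlowup.π I).appTop.hom.comp (Scheme.ΓSpecIso (.of R)).inv.hom)) p hp.ne_zero
  exact ⟨inferInstance, fun d _ s _ u c hc hu =>
    (isTightlyClosed_iff_of_isDomain p).mp (isTightlyClosed_of_isRegularLocalRing p _) u c hc hu⟩

end Summit.ResolutionOfSingularities.ResolutionOfSingularities.Theorems.FRationalModification.BlowupCertificateOfRegularBlowup

end
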